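import Mathlib
import Summits.Ventures.HodgeRepro.Tier4.Target
import Summits.Ventures.HodgeRepro.Tier4.Common.TargetBall
import Summits.Ventures.HodgeRepro.Tier4.Line3.Defs
import Summits.Ventures.HodgeRepro.Tier4.Line3.LocaliserS
import Summits.Ventures.HodgeRepro.Tier4.Line3.CongruenceIndex
import Summits.Ventures.HodgeRepro.Tier4.Line3.DomainTransfer
import Summits.Ventures.HodgeRepro.Tier4.Line3.KernelIntegrable
import Summits.Ventures.HodgeRepro.Tier4.Line3.InvariantDensityTransfer
import Summits.Ventures.HodgeRepro.Tier4.Line3.GoodDomainCovering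
import Summits.Ventures.HodgeRepro.Tier4.Line3.OffMainInvariance
import Summits.Ventures.HodgeRepro.Tier4.Line3.TermDominatedAssembly

/-!
# Tier4/Line3/InvariantMajorantGlue — the off-main mass bound from a `Γ`-INVARIANT majorant (no good domain)

Blind re-derivation cell `pub-hodge-repro`, Tier 4 «PROVE THE STEP» (README §9–§10), LINE L3, seat t4-L2-p3 (gen 2,
successor of gen 0 on L3.5 `term_dominated`, lead S12860 (R-VII)); support module for the residual `OffMainMass` of
L3.5 (t4-L2-p1's `TermDominatedAssembly`).

The residual `OffMainMass` bounds the off-main mass of the depth-`N` level, `∫⁻_{D_N} ρ_N`, by `M₀ q₁^N e^{−κ q^{N/d}}`.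
The route through a `Γ_N`-fundamental domain tiled by coset representatives `r⁻¹(F)` (t4-L2-p1's
`GoodDomainCovering`) costs the ARCHIMEDEAN SIZE of the representatives `r` of `(Γ ∩ Γ(q₀^N))\Γ` (the boundary
distance of the tiles) — which no lemma of the tree provides and which, for the cocompact `Γ` of an anisotropic
`H`, is an expander-type input of its own (S12951).  This module shows the size of the representatives is NOT
needed once the majorant of the off-main density is a `Γ`-INVARIANT density: if `μ` is `Γ`-invariant
(`IsInvariantDensity τ₀ C Γ μ`), `ρ_N ≤ K q₂^N e^{−κ q^{N/d}} · μ` on the ball for every depth, and `μ` has finite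
mass over ONE fundamental domain `F` of `Γ`, then

  `∫⁻_{D_N} ρ_N ≤ Σ_{r ∈ R} ∫⁻_{r⁻¹(F)} ρ_N ≤ K q₂^N e^{−κ q^{N/d}} Σ_{r ∈ R} ∫⁻_{r⁻¹(F)} μ
     = K q₂^N e^{−κ q^{N/d}} · |R| · ∫⁻_F μ ≤ K M_F (q₂ q₀^{9d})^N e^{−κ q^{N/d}}`

— the cover by the translates (`lintegral_domain_le_sum_translates`, ANY representatives), the change of variables
`∫⁻_{r⁻¹(F)} μ = ∫⁻_F μ` (`lintegral_image_actM` + the invariance of `μ`), and the index bound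
`|R| ≤ (q₀^{dN})^9` (`CongruenceIndex.exists_cosetReps_principalCongruence` with `LocS.level_le`).  Nothing about the
distance of the tiles from the boundary enters.  The hypotheses displayed on `offMainMass_of_invariantMajorant` are
the honest residual of L3.5 in this shape: the invariant majorant of the class bound and its finite mass over `F`.

No printed input enters this module.  Nothing here asserts anything about the truth of (P); HC_CM is NOT proved by
anyone in this repository.
-/

set_option autoImplicit false

noncomputable section

namespace Summit.Ventures.HodgeRepro.Tier4.Line3

open Summit.Ventures.HodgeRepro.Tier4
open Matrix MeasureTheory
open scoped ComplexConjugate ENNReal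

namespace T4Data

variable (X : T4Data)

/-- The chosen domain of a level is `∅` or a fundamental domain of the level (by its definition). -/
theorem domain_eq_empty_or_isFundamentalDomainFor (K : X.Level) :
    X.domain K = ∅ ∨ IsFundamentalDomainFor (ballActions X.τ₀ X.C K.1) (X.domain K) := by
  unfold T4Data.domain
  split_ifs with hD
  · exact Or.inr (Classical.choose_spec hD).1
  · exact Or.inl rfl

/-- The conjugation of `E′` is intertwined by `τ₀` with complex conjugation (the `hτ` of the transfer lemmas). -/
theorem tau_conj (x : X.E) : X.τ₀ (X.c x) = conj (X.τ₀ x) :=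
  complexConj_intertwines X.E X.τ₀ x

/-- **THE CHANGE OF VARIABLES FOR AN INVARIANT DENSITY**: `∫⁻_{γ(F)} μ = ∫⁻_F μ` for `γ ∈ Γ`, `F ⊆ 𝔹` measurable and
`μ` a `Γ`-invariant density. -/
theorem lintegral_image_eq_of_isInvariantDensity {F : Set (Fin 2 → ℂ)} (hFm : MeasurableSet F) (hFb : F ⊆ ball)
    {μ : (Fin 2 → ℂ) → ℝ≥0∞} (hμ : IsInvariantDensity X.τ₀ X.C X.Γ μ) {γ : Matrix (Fin 3) (Fin 3) X.E}
    (hγ : γ ∈ X.Γ) :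
    ∫⁻ z in actM (toBallMat X.τ₀ X.C γ) '' F, μ z = ∫⁻ z in F, μ z := by
  have hM : (toBallMat X.τ₀ X.C γ)ᴴ * J * toBallMat X.τ₀ X.C γ = J :=
    toBallMat_unitaryJ X.hΓ X.tau_conj X.hC hγ
  rw [lintegral_image_actM hM hFm hFb μ]
  refine setLIntegral_congr_fun hFm fun z hz => ?_
  exact hμ (actM (toBallMat X.τ₀ X.C γ)) ⟨γ, hγ, rfl⟩ z (hFb hz)

/-- **THE OFF-MAIN MASS BOUND FROM A `Γ`-INVARIANT MAJORANT** (no good domain, no size of the coset representatives):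
if `μ` is a `Γ`-invariant density on the ball with finite mass over a fundamental domain `F` of `Γ`, and the off-main
density of the depth-`N` localiser is at most `K q₂^N e^{−κ q^{N/d}} · μ` on the ball for every `N`, then the
residual `OffMainMass` of L3.5 holds (with `M₀ = K M_F` and `q₁ = q₂ · q₀^{9d}`, `q₀` the prime power of
`LocS.level_le`). -/
theorem offMainMass_of_invariantMajorant (D : X.ThetaData)
    (p : IsDedekindDomain.HeightOneSpectrum (NumberField.RingOfIntegers X.E))
    (L₀ : Submodule (NumberField.RingOfIntegers X.E) (Fin 3 → X.E)) (xm : X.Tuple) (ℓ : X.LocS D p L₀ xm)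
    {F : Set (Fin 2 → ℂ)} (hF : IsFundamentalDomainFor (ballActions X.τ₀ X.C X.Γ) F)
    (μ : (Fin 2 → ℂ) → ℝ≥0∞)
    (hμ : IsInvariantDensity X.τ₀ X.C X.Γ μ) {M_F : ℝ} (hMF : 0 ≤ M_F)
    (hμF : ∫⁻ z in F, μ z ≤ ENNReal.ofReal M_F)
    {K q₂ κ : ℝ} (hK : 0 ≤ K) (hq₂ : 0 ≤ q₂) (hκ : 0 < κ)
    (hpt : ∀ N : ℕ, ∀ z ∈ ball, X.offMainDensity D (ℓ.loc N) xm z ≤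
      ENNReal.ofReal (K * q₂ ^ N * X.offMainDecay p κ N) * μ z) :
    Nonempty (X.OffMainMass D p L₀ xm ℓ) := by
  obtain ⟨q₀, hq₀, hlev⟩ := ℓ.level_le
  set d : ℕ := Module.finrank ℚ X.E with hd
  refine ⟨⟨κ, hκ, K * M_F, q₂ * ((q₀ : ℝ) ^ d) ^ 9, mul_nonneg hK hMF, by positivity, fun N => ?_⟩⟩
  -- the off-main density at depth `N`
  set ρ : (Fin 2 → ℂ) → ℝ≥0∞ := X.offMainDensity D (ℓ.loc N) xm with hρ
  have hρeq : (fun z => ∑' w : {w : X.LineTuple // X.orbitOf w ≠ X.orbitOf (X.lines xm)},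
      ‖X.summand D.Φ D.cf (ℓ.loc N) w.1 z‖ₑ) = ρ := by
    funext z
    rfl
  have hdec0 : 0 ≤ X.offMainDecay p κ N := X.offMainDecay_nonneg p κ N
  set c : ℝ≥0∞ := ENNReal.ofReal (K * q₂ ^ N * X.offMainDecay p κ N) with hc
  show ∫⁻ z in X.domain (ℓ.level N), ∑' w : {w : X.LineTuple // X.orbitOf w ≠ X.orbitOf (X.lines xm)},
      ‖X.summand D.Φ D.cf (ℓ.loc N) w.1 z‖ₑ ≤ ENNReal.ofReal (K * M_F * (q₂ * ((q₀ : ℝ) ^ d) ^ 9) ^ N *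
        X.offMainDecay p κ N)
  rw [hρeq]
  rcases X.domain_eq_empty_or_isFundamentalDomainFor (ℓ.level N) with hdom | hdom
  · rw [hdom, Measure.restrict_empty, lintegral_zero_measure]
    exact zero_le
  -- the coset representatives of `Γ ∩ Γ(q₀^N)` in `Γ`
  have hM1 : 1 ≤ q₀ ^ N := Nat.one_le_pow _ _ hq₀
  obtain ⟨R, hRf, hRΓ, hcard, hR⟩ := exists_cosetReps_principalCongruence X.c X.H X.hΓ (q₀ ^ N) hM1
  have hinv' : ∀ r ∈ R, ∃ h : Matrix (Fin 3) (Fin 3) X.E, h ∈ X.Γ ∧ h * r = 1 := by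
    intro r hr
    obtain ⟨h, hh, _, hhr⟩ := exists_two_sided_inv_mem X.c X.H X.hΓ (hRΓ hr)
    exact ⟨h, hh, hhr⟩
  choose! inv hinv using hinv'
  have hR' : ∀ γ ∈ X.Γ, ∃ r ∈ R, ∃ δ ∈ (ℓ.level N).1, γ = r * δ := by
    intro γ hγ
    obtain ⟨r, hr, δ, hδ, rfl⟩ := hR γ hγ
    exact ⟨r, hr, δ, hlev N hδ, rfl⟩
  haveI : Fintype R := hRf.fintype
  -- the translates lie in the ball and are measurable
  have hsub : ∀ r : R, actM (toBallMat X.τ₀ X.C (inv r.1)) '' F ⊆ ball := fun r =>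
    translate_subset_ball X.hΓ X.tau_conj X.hC (hinv r.1 r.2).1 hF.2.1
  have hmeas : ∀ r : R, MeasurableSet (actM (toBallMat X.τ₀ X.C (inv r.1)) '' F) := fun r =>
    measurableSet_image_actM (toBallMat_unitaryJ X.hΓ X.tau_conj X.hC (hinv r.1 r.2).1) hF.1 hF.2.1
  -- the index bound, in `ℝ≥0∞`
  have hcardE : (Nat.card R : ℝ≥0∞) ≤ ENNReal.ofReal (((q₀ : ℝ) ^ d) ^ 9) ^ N := by
    have h1 : (Nat.card R : ℝ≥0∞) ≤ (((q₀ ^ N) ^ d) ^ 9 : ℕ) := by exact_mod_cast hcard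
    refine h1.trans (le_of_eq ?_)
    rw [← ENNReal.ofReal_natCast, ← ENNReal.ofReal_pow (by positivity)]
    congr 1
    push_cast
    ring
  calc ∫⁻ z in X.domain (ℓ.level N), ρ z
      ≤ ∑' r : R, ∫⁻ z in actM (toBallMat X.τ₀ X.C (inv r.1)) '' F, ρ z :=
        lintegral_domain_le_sum_translates X.hΓ (ℓ.level N).2.1 X.tau_conj X.hC hdom hF hRf hR' inv hinv
          (X.aemeasurable_offMainDensity D (ℓ.loc N) xm) (X.offMainDensity_isInvariant D (ℓ.level N) (ℓ.loc N) xm)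
    _ ≤ ∑' r : R, ∫⁻ z in actM (toBallMat X.τ₀ X.C (inv r.1)) '' F, c * μ z := by
        refine ENNReal.tsum_le_tsum fun r => ?_
        refine lintegral_mono_ae ((ae_restrict_iff' (hmeas r)).mpr (Filter.Eventually.of_forall fun z hz => ?_))
        exact hpt N z (hsub r hz)
    _ = ∑' r : R, c * ∫⁻ z in F, μ z := by
        refine tsum_congr fun r => ?_
        rw [lintegral_const_mul' _ _ ENNReal.ofReal_ne_top,
          X.lintegral_image_eq_of_isInvariantDensity hF.1 hF.2.1 hμ (hinv r.1 r.2).1]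
    _ = (Nat.card R : ℝ≥0∞) * (c * ∫⁻ z in F, μ z) := by
        rw [tsum_fintype, Finset.sum_const, Finset.card_univ, nsmul_eq_mul, Nat.card_eq_fintype_card]
    _ ≤ ENNReal.ofReal (((q₀ : ℝ) ^ d) ^ 9) ^ N * (c * ENNReal.ofReal M_F) :=
        mul_le_mul hcardE (mul_le_mul_right hμF _) bot_le bot_le
    _ = ENNReal.ofReal (K * M_F * (q₂ * ((q₀ : ℝ) ^ d) ^ 9) ^ N * X.offMainDecay p κ N) := by
        rw [hc, ← ENNReal.ofReal_pow (by positivity), ← ENNReal.ofReal_mul (by positivity),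
          ← ENNReal.ofReal_mul (by positivity)]
        congr 1
        ring

end T4Data

end Summit.Ventures.HodgeRepro.Tier4.Line3

end
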